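import Summits.CriticalPhenomena.CardyFormulaZ2.Theorems.CardyComplexConeEdgeCoherenceHarmonicSplit
import Summits.CriticalPhenomena.CardyFormulaZ2.Theorems.CardyComplexConeEdgeCoherenceHarmonicSplitMorera

/-!
# SKELETON v2 of line `harmonic-split` for the crux `CardyComplexCone.EdgeCoherence` (stmt-CriticalPhenomena-11385)

Crux strategist `planner-cstrat-stmt-CriticalPhenomena-11385-s2-0` (gen 1, 2026-08-17), refreshing strategist s1's
line of the same name onto the LANDED vocabulary: every definition and the glue of the line now live in
`Theorems/CardyComplexConeEdgeCoherenceHarmonicSplit.lean` (p147898, landed verbatim by the line lead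
`prover-line-stmt-CriticalPhenomena-11385-c2-0`) and `Theorems/CardyComplexConeEdgeCoherenceHarmonicSplitMorera.lean`
(p148310); this file only imports them, states the THREE REGISTERED STUBS over the landed fully-qualified
names, and composes the crux BY NAME.  It is an ALTERNATIVE line: the lead's live skeleton
`Cruxes/EdgeCoherence/Lines/Sketch.lean` (composition `LeeYang`, stubs `stub_domination` / `stub_classBalance` /
`stub_envelope0`) is untouched; the three stubs below are registered additively (`ledger workitem stub-add`).

Write `E_c(v) = E_δ(v, faceAt v c)` for the four corner values of the spin-`1/3` corner observable at a primal
vertex `v` (classes `c = 0,1,2,3` ↔ faces `v, v−e₀, v−e₀−e₁, v−e₁`) and `H_k(v) = Σ_c i^{kc} E_c(v)` for their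
`ℤ₄`-harmonics.  The crux with the witness `u ≡ 1` is `H₁, H₂, H₃ = o(δ^{1/3})` locally uniformly
(`HarmonicVanishing`, landed `stub_aliasing`, p87880).  The line:

* `stub_latticeRegularity : LatticeClassRegularity` — same-class corner values at lattice NEIGHBOURS agree to
  `o(δ^{1/3})` (support; ⟸ `EdgePrecompact` (ii) by the landed `latticeClassRegularity_of_edgePrecompact`, and it
  has an independent cheaper road: by translation covariance it is forgetting of an `O(δ)` translation of the far
  boundary — couple the two explorations on one configuration, boundary-rooted half-plane three-arm events +
  `±2π` winding slips);
* `stub_alternatingMode : AlternatingModeNull` — `H₂ = E₀ − E₁ + E₂ − E₃ = o(δ^{1/3})` (crux-sized; THE piece the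
  route consumes: `coherentMorera_of_alternatingModeNull`, p148310; in the potential form of the landed Kirchhoff
  relation it says that the face potential `Φ|_F` of the closed twisted corner form is asymptotically
  discrete-HOLOMORPHIC plaquette by plaquette — the dual half of discrete Cauchy–Riemann at leading order; in the
  `ℤ₁₂` bookkeeping of the turning index `m` of a passage (`m mod 12` = (class, `ℤ₃` sheet)) it is the nullity of
  the frequency-`5` mode, the signal being frequency `−1`);
* `stub_chiralMode : ChiralModeNull` — `H₁ = E₀ + iE₁ − E₂ − iE₃ = o(δ^{1/3})` (crux-sized; the numerically dominant
  alias, relative size `δ^{1/4}`; potential form: `Φ` has the MEAN-VALUE property across the two sublattices,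
  `Φ(v) = ¼ Σ_c Φ(f_c) + o(δ^{1/3})`; `ℤ₁₂` mode `2`; surplus to the route's assembly);

and the composition `EdgeCoherence_of := EdgeCoherence_of_subs stub_latticeRegularity stub_alternatingMode
stub_chiralMode` — the fourth harmonic `H₃` (`ℤ₁₂` mode `8`) being slaved EXACTLY by Kirchhoff,
`H₃(v) = (E₂(v+e₀) − E₂(v)) + i (E₁(v+e₀) − E₁(v))` (`harmonic_three_eq`, landed).

Two kernel-checked REMARKS for the tenure planner ride along (no `sorry`): `WeakAlternatingModeNull` — the
test-function form `δ^{5/3} Σ_v H₂(v) ∂φ(δv) → 0` — is the WEAKEST hypothesis from this crux that the route's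
`closes` needs (`coherentMoreraConclusion_of_weakAlternatingModeNull`, `coherentMorera_of_weakAlternatingModeNull`),
and it follows from the pointwise stub (`weakAlternatingModeNull_of_alternatingModeNull`).

References: H. Duminil-Copin, *Parafermionic observables and their applications*, arXiv:1208.3787, Prop. 4;
H. Duminil-Copin, S. Smirnov, *Conformal invariance of lattice models*, Clay Math. Proc. 15 (2012), §8 (Prop. 8.6,
Conj. 8.7); S. Smirnov, Ann. Math. 172 (2010), §4 (the `q = 2` sibling); C. Garban, G. Pete, O. Schramm, JAMS 26
(2013), §3 (coupling); crux files `STRATEGY-CENSUS.md` (s1, s2), `DECOMPOSITION.md`, `Lines/harmonic-split.md`.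
-/

noncomputable section

namespace Summit.CriticalPhenomena.CardyFormulaZ2.Cruxes.EdgeCoherence.HarmonicSplitLine

open scoped BigOperators Topology
open Filter Set MeasureTheory
open Literature.Probability.LatticeModels Literature.Probability.RandomPlanarGeometry
open Literature.Probability.Percolation (BondConfig bondPercolation half)
open Summit.CriticalPhenomena.CardyFormulaZ2.Theses.CardyComplexCone (EdgeCoherence EdgePrecompact CoherentMorera)
open Summit.CriticalPhenomena.CardyFormulaZ2.Cruxes.EdgeCoherence.HarmonicSplit
  (LatticeClassRegularity AlternatingModeNull ChiralModeNull SlavedModeNull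
   EdgeCoherence_of_subs slavedModeNull_of latticeClassRegularity_of_edgePrecompact
   scaledNull_P2_of_alternatingModeNull)
open Summit.CriticalPhenomena.CardyFormulaZ2.Cruxes.CoherentMorera.FinitaryGreenPairing
  (Guards TestFn ScaledNull P0 P2 PV VertexPrecompactAt scaledNull_of_sub_of_or
   spinShift_of stub_pairingBound stub_kirchhoff stub_siteRegrouping stub_traceIdentity stub_precompactTransfer)

/-! ## The three registered stubs (signatures over the landed fully-qualified names) -/

/-- Registered stub 1 (support): LATTICE-SCALE SAME-CLASS REGULARITY. -/
theorem stub_latticeRegularity :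
    Summit.CriticalPhenomena.CardyFormulaZ2.Cruxes.EdgeCoherence.HarmonicSplit.LatticeClassRegularity := by
  sorry

/-- Registered stub 2 (crux-sized; the piece the route consumes): the ALTERNATING (spin-`5/3`) MODE IS NULL. -/
theorem stub_alternatingMode :
    Summit.CriticalPhenomena.CardyFormulaZ2.Cruxes.EdgeCoherence.HarmonicSplit.AlternatingModeNull := by
  sorry

/-- Registered stub 3 (crux-sized; surplus to the assembly): the CHIRAL (spin-`2/3`) MODE IS NULL. -/
theorem stub_chiralMode :
    Summit.CriticalPhenomena.CardyFormulaZ2.Cruxes.EdgeCoherence.HarmonicSplit.ChiralModeNull := by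
  sorry

/-! ## The composition: the line closes the crux BY NAME modulo its three stubs -/

/-- The slaved (spin-`4/3`) mode from stub 1 alone (landed `slavedModeNull_of`: Kirchhoff slaving). -/
theorem slavedMode_of_line : SlavedModeNull :=
  slavedModeNull_of stub_latticeRegularity

/-- **`EdgeCoherence` (by name) from the three stubs**, by the landed glue `EdgeCoherence_of_subs` (p147898). -/
theorem EdgeCoherence_of : EdgeCoherence :=
  EdgeCoherence_of_subs stub_latticeRegularity stub_alternatingMode stub_chiralMode

/-- What the ROUTE consumes from this line: `CoherentMorera` from stub 2 alone (landed p148310). -/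
theorem coherentMorera_of_line : CoherentMorera :=
  Summit.CriticalPhenomena.CardyFormulaZ2.Cruxes.EdgeCoherence.HarmonicSplit.coherentMorera_of_alternatingModeNull
    stub_alternatingMode

/-- Stub 1 has a landed road through the route's rank-3 crux `EdgePrecompact` (stmt-CriticalPhenomena-11387). -/
theorem stub_latticeRegularity_of_edgePrecompact (hP : EdgePrecompact) :
    Summit.CriticalPhenomena.CardyFormulaZ2.Cruxes.EdgeCoherence.HarmonicSplit.LatticeClassRegularity :=
  latticeClassRegularity_of_edgePrecompact hP

/-! ## Remarks for the tenure planner (kernel-checked, no `sorry`): the weakest re-glue hypothesis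

`CoherentMorera` uses `EdgeCoherence` only through `ScaledNull P₀ ∨ ScaledNull P₂`; the weak (test-function)
nullity of the alternating pairing `P₂ = Σ_v A₂(v) ∂φ(δv)` is therefore ALL the route needs from this crux. -/

/-- WEAK ALTERNATING-MODE NULL: for every Dobrushin domain, every guarded discretisation family and every
admissible test function, `δ^{5/3} · Σ_v (E₀ − E₁ + E₂ − E₃)(v) ∂φ(δv) → 0` as `δ → 0⁺`. -/
def WeakAlternatingModeNull : Prop :=
  ∀ (D : DobrushinDomain) (Λ : ℝ → DiscreteDobrushin), Guards D Λ → ∀ φ : ℂ → ℂ, TestFn D φ →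
    ScaledNull (P2 Λ φ)

/-- The pointwise stub implies the weak form (landed `scaledNull_P2_of_alternatingModeNull`). -/
theorem weakAlternatingModeNull_of_alternatingModeNull (h2 : AlternatingModeNull) : WeakAlternatingModeNull :=
  fun D Λ hG φ hT => scaledNull_P2_of_alternatingModeNull h2 D Λ hG φ hT

/-- **Both conclusions of `CoherentMorera` from the WEAK alternating mode + `EdgePrecompact`** (verbatim the landed
proof of `coherentMoreraConclusion_of_alternatingModeNull` with the weak hypothesis fed directly). -/
theorem coherentMoreraConclusion_of_weakAlternatingModeNull : WeakAlternatingModeNull → EdgePrecompact →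
    (∀ (D : DobrushinDomain) (Λ : ℝ → DiscreteDobrushin), (∀ δ, (Λ δ).Ω = D.carrier) →
        (∀ δ, (Λ δ).δ = δ) → (∀ᶠ δ in 𝓝[>] (0:ℝ), (Λ δ).IsZdAdmissible) →
          ∀ φ : ℂ → ℂ, ContDiff ℝ (⊤ : ℕ∞) φ → HasCompactSupport φ → tsupport φ ⊆ D.carrier →
            ScaledNull (PV Λ φ)) ∧
      (∀ (D : DobrushinDomain) (Λ : ℝ → DiscreteDobrushin), (∀ δ, (Λ δ).Ω = D.carrier) →
        (∀ δ, (Λ δ).δ = δ) → (∀ᶠ δ in 𝓝[>] (0:ℝ), (Λ δ).IsZdAdmissible) → VertexPrecompactAt D Λ) := by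
  intro hW hP
  refine ⟨?_, ?_⟩
  · intro D Λ hΩ hδ hadm φ hφ hsupp hsub
    have hG : Guards D Λ := ⟨hΩ, hδ, hadm⟩
    have hT : TestFn D φ := ⟨hφ, hsupp, hsub⟩
    have h0 : ScaledNull (P0 Λ φ) :=
      scaledNull_of_sub_of_or (spinShift_of stub_pairingBound stub_kirchhoff D Λ hG φ hT)
        (Or.inr (hW D Λ hG φ hT))
    exact (stub_siteRegrouping D Λ hG (stub_traceIdentity D Λ hG) φ hT).2 h0
  · intro D Λ hΩ hδ hadm
    exact stub_precompactTransfer hP D Λ ⟨hΩ, hδ, hadm⟩ (stub_traceIdentity D Λ ⟨hΩ, hδ, hadm⟩)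

/-- Certificate: the conclusion above IS `CoherentMorera`'s, so `WeakAlternatingModeNull → CoherentMorera`. -/
theorem coherentMorera_of_weakAlternatingModeNull (hW : WeakAlternatingModeNull) : CoherentMorera :=
  fun _ hP => coherentMoreraConclusion_of_weakAlternatingModeNull hW hP

end Summit.CriticalPhenomena.CardyFormulaZ2.Cruxes.EdgeCoherence.HarmonicSplitLine

end
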